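import Summits.MatrixMultiplication.MatrixMultiplication.Theorems.ConeTensorCore
import Summits.MatrixMultiplication.MatrixMultiplication.Theorems.TetrahedronTensorConsequences
import HarnessLib

/-!
# ConeTensor — the exponent `ω(W)` of the squared-spoke cone, the bracket `6 ≤ ω(W) ≤ 3ω`, the exact
cut `ω = 2 ⟺ [ω(W) ≤ 6] ∧ [3ω ≤ ω(W)]`, and what `ω(W) ≤ 6` gives alone: `ω(1,1,2) = 3`, `α ≥ 2/3`, `ω ≤ 9/4`

(decomp-mm lens 6 «barrier-complement carving», gen 14; kernel of the node `ConeCarving`, the spoke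
deformation `s = 2` of the tetrahedron carving. Companion of `ConeTensorCore` (the tensor `W_n`,
cover `R₄(W_n) ≤ R(⟨n,n,n⟩)³`, grouping `R(⟨n⁴,n²,n²⟩) ≤ R₄(W_n)`, flattening `n⁶ ≤ R₄(W_n)`).)

Sources: Christandl–Vrana–Zuiddam, arXiv:1609.07476 [CVZ19], Def. 1.1.13/1.1.25 (exponent of a
family closed under `⊠`), Prop. 1.1.16 (exponent = asymptotic log-rank), §1.2 (flattening lower
bounds), §1.3 («if `ω = 2` then every graph tensor is flat»); Lotti–Romani 1983 [LottiRomani1983]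
(subadditivity / homogeneity of `ω(·,·,·)`); Huang–Pan 1998 [HuangPan1998] §2 (2.8) (information
bound); the census instrument table `census/data/cllz-cw-rect-barrier-v2.md` (decomp-mm-census-1,
gen 2; CLLZ arXiv:2003.03019): row `k = 2` of Table A — every `CW_q`-method upper bound on `ω(1,2,1)`
is `≥ 3.0551`, so the consequence `ω(1,1,2) = 3` of `ω(W) ≤ 6` proved below is OUTSIDE the reach of
the Coppersmith–Winograd family (barrier placement of the attacked piece `ConeFlat`).

What is proved here (sorry-free): `coneAdmissibleExponents`, `omegaCone` (`ω(W)`);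
`six_le_omegaCone`, `omegaCone_le_nine`; `three_mul_mem_coneAdmissibleExponents` and
`omegaCone_le_three_mul_omega : ω(W) ≤ 3ω` (every field); over `ℂ` against the summit statement
`_root_.MatrixMultiplication` (`ω(ℂ) = 2`): both necessities, the sufficiency and the exactness
`matrixMultiplication_iff_cone : ω = 2 ⟺ [ω(W) ≤ 6] ∧ [3ω ≤ ω(W)]`; the grouping consequences
`omegaRect_four_two_two_le_omegaCone : ω(4,2,2) ≤ ω(W)`, `omegaRect_one_one_two_eq_three_of_omegaCone_le_six :
ω(W) ≤ 6 → ω(1,1,2) = 3` (record `ω(1,1,2) < 3.2504`), `twoThirds_le_dualExponentAlpha_of_omegaCone_le_six :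
ω(W) ≤ 6 → 2/3 ≤ α` (record `α > 0.321334`; `ω(2,3,3) ≤ ω(1,1,2) + ω(1,2,1)`) and
`omega_le_nine_fourths_of_omegaCone_le_six : ω(W) ≤ 6 → ω ≤ 9/4`. No `sorry`, no new axiom, no
instance, no notation, no `Prop`-valued definition.
-/

noncomputable section

set_option linter.dupNamespace false

open scoped BigOperators
open Filter Asymptotics Module
open Literature.Computability.AlgebraicComplexity
open Summit.MatrixMultiplication.MatrixMultiplication.Theorems.TetrahedronTensor

namespace Summit.MatrixMultiplication.MatrixMultiplication.Theorems.ConeTensor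

/-! ## The exponent `ω(W)` and the bracket `6 ≤ ω(W) ≤ 9` -/

section Exponent

variable (F : Type*) [Field F]

/-- Admissible exponents of the squared-spoke cone: `{β | R₄(W_n) = O(n^β)}` (the family
`(W_n)_n` is closed under `⊠` up to relabelling, CVZ19 Def. 1.1.13 / Prop. 1.1.16).
(CVZ19, Def. 1.1.13). -/
def coneAdmissibleExponents : Set ℝ :=
  {β : ℝ | (fun n : ℕ => (tensorRankD (cone F n) : ℝ)) =O[atTop] fun n : ℕ => (n : ℝ) ^ β}

/-- **The exponent of the squared-spoke cone** `ω(W) = inf {β | R₄(W_n) = O(n^β)}`. Known (below):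
`6 ≤ ω(W) ≤ 3ω < 7.12`; `ω(4,2,2) ≤ ω(W)`. (CVZ19, Def. 1.1.25). -/
def omegaCone : ℝ :=
  sInf (coneAdmissibleExponents F)

/-- `9` is admissible (`R₄(W_n) ≤ n⁹`). [cite: ChristandlVranaZuiddam2016, §1.2 (table)] -/
theorem nine_mem_coneAdmissibleExponents : (9 : ℝ) ∈ coneAdmissibleExponents F := by
  refine IsBigO.of_bound 1 (Eventually.of_forall fun n => ?_)
  rw [one_mul, Real.norm_of_nonneg (Nat.cast_nonneg _),
    Real.norm_of_nonneg (Real.rpow_nonneg (Nat.cast_nonneg _) _)]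
  have h := tensorRankD_cone_le_pow_nine (F := F) n
  calc (tensorRankD (cone F n) : ℝ) ≤ (n ^ 9 : ℕ) := by exact_mod_cast h
    _ = (n : ℝ) ^ (9 : ℝ) := by
      rw [show (9 : ℝ) = (9 : ℕ) by norm_num, Real.rpow_natCast]
      push_cast
      ring

/-- Every admissible exponent of the cone is `≥ 6` (flattening `n⁶ ≤ R₄(W_n)`).
[cite: ChristandlVranaZuiddam2016, §1.2 (eq. (flat))] -/
theorem six_le_of_mem_coneAdmissibleExponents {β : ℝ} (hβ : β ∈ coneAdmissibleExponents F) :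
    6 ≤ β := by
  by_contra hlt
  rw [not_le] at hlt
  obtain ⟨C, hC⟩ := isBigO_iff.1 hβ
  have hev : ∀ᶠ n : ℕ in atTop, (n : ℝ) ^ (6 - β) ≤ C := by
    filter_upwards [hC, eventually_gt_atTop 0] with n hn hn0
    have hn0' : (0 : ℝ) < n := Nat.cast_pos.2 hn0
    rw [Real.norm_of_nonneg (Nat.cast_nonneg _),
      Real.norm_of_nonneg (Real.rpow_nonneg (Nat.cast_nonneg _) _)] at hn
    have h6 : (n : ℝ) ^ (6 : ℝ) ≤ C * (n : ℝ) ^ β := by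
      refine le_trans ?_ hn
      rw [show (6 : ℝ) = (6 : ℕ) by norm_num, Real.rpow_natCast]
      exact_mod_cast pow_six_le_tensorRankD_cone' (F := F) n
    rw [Real.rpow_sub hn0', div_le_iff₀ (Real.rpow_pos_of_pos hn0' _)]
    exact h6
  have hlim : Tendsto (fun n : ℕ => (n : ℝ) ^ (6 - β)) atTop atTop :=
    (tendsto_rpow_atTop (by linarith)).comp tendsto_natCast_atTop_atTop
  obtain ⟨n, hn₁, hn₂⟩ := (hev.and (hlim.eventually_gt_atTop C)).exists
  exact absurd hn₁ (not_le.2 hn₂)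

/-- The admissible exponents of the cone are nonempty. [folklore] -/
theorem coneAdmissibleExponents_nonempty : (coneAdmissibleExponents F).Nonempty :=
  ⟨9, nine_mem_coneAdmissibleExponents F⟩

/-- The admissible exponents of the cone are bounded below (by `6`). [folklore] -/
theorem coneAdmissibleExponents_bddBelow : BddBelow (coneAdmissibleExponents F) :=
  ⟨6, fun _ hβ => six_le_of_mem_coneAdmissibleExponents F hβ⟩

/-- Admissible exponents are upward closed. [folklore] -/
theorem mem_coneAdmissibleExponents_of_le {β γ : ℝ} (hβ : β ∈ coneAdmissibleExponents F)
    (h : β ≤ γ) : γ ∈ coneAdmissibleExponents F := by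
  refine hβ.trans ?_
  refine IsBigO.of_bound 1 ?_
  filter_upwards [eventually_ge_atTop 1] with n hn
  have hn' : (1 : ℝ) ≤ n := by exact_mod_cast hn
  rw [one_mul, Real.norm_of_nonneg (Real.rpow_nonneg (by positivity) _),
    Real.norm_of_nonneg (Real.rpow_nonneg (by positivity) _)]
  exact Real.rpow_le_rpow_of_exponent_le hn' h

/-- **`ω(W) ≥ 6`** (flattening across the apex cut `0 | 123`, or `01 | 23`).
[cite: ChristandlVranaZuiddam2016, §1.2] -/
theorem six_le_omegaCone : 6 ≤ omegaCone F :=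
  le_csInf (coneAdmissibleExponents_nonempty F)
    fun _ hβ => six_le_of_mem_coneAdmissibleExponents F hβ

/-- `ω(W) ≤ 9` (trivial cover by the nine unit edges). [cite: ChristandlVranaZuiddam2016, §1.2] -/
theorem omegaCone_le_nine : omegaCone F ≤ 9 :=
  csInf_le (coneAdmissibleExponents_bddBelow F) (nine_mem_coneAdmissibleExponents F)

/-- Any exponent strictly above `ω(W)` is admissible. [folklore] -/
theorem mem_coneAdmissibleExponents_of_lt {β : ℝ} (h : omegaCone F < β) :
    β ∈ coneAdmissibleExponents F := by
  obtain ⟨γ, hγ, hγβ⟩ := (csInf_lt_iff (coneAdmissibleExponents_bddBelow F)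
    (coneAdmissibleExponents_nonempty F)).1 h
  exact mem_coneAdmissibleExponents_of_le F hγ hγβ.le

/-! ## The triangle cover `ω(W) ≤ 3ω` -/

/-- If `β` is an admissible exponent for `⟨n,n,n⟩`, then `3β` is admissible for the cone
(`R₄(W_n) ≤ R(⟨n,n,n⟩)³`). [cite: ChristandlVranaZuiddam2016, Prop. 1.1.16] -/
theorem three_mul_mem_coneAdmissibleExponents {β : ℝ} (hβ : β ∈ admissibleExponents F) :
    3 * β ∈ coneAdmissibleExponents F := by
  obtain ⟨C, hC0, hC⟩ := isBigO_iff'.1 hβ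
  refine IsBigO.of_bound (C ^ 3) ?_
  filter_upwards [hC] with n hn
  rw [Real.norm_of_nonneg (Nat.cast_nonneg _),
    Real.norm_of_nonneg (Real.rpow_nonneg (Nat.cast_nonneg _) _)] at hn ⊢
  have hn0 : (0 : ℝ) ≤ n := Nat.cast_nonneg _
  have hpow : ((n : ℝ) ^ β) ^ 3 = (n : ℝ) ^ (3 * β) := by
    rw [← Real.rpow_natCast ((n : ℝ) ^ β) 3, ← Real.rpow_mul hn0]
    congr 1
    push_cast
    ring
  calc (tensorRankD (cone F n) : ℝ)
      ≤ ((tensorRank (matMulTensor F n n n) : ℕ) : ℝ) ^ 3 := by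
        exact_mod_cast tensorRankD_cone_le (F := F) n
    _ ≤ (C * (n : ℝ) ^ β) ^ 3 := pow_le_pow_left₀ (Nat.cast_nonneg _) hn 3
    _ = C ^ 3 * (n : ℝ) ^ (3 * β) := by rw [mul_pow, hpow]

/-- **The triangle cover `ω(W) ≤ 3ω`** (three apex triangles), for every field.
[cite: ChristandlVranaZuiddam2016, Prop. 1.1.16] -/
theorem omegaCone_le_three_mul_omega : omegaCone F ≤ 3 * omega F := by
  have h : ∀ β ∈ admissibleExponents F, omegaCone F / 3 ≤ β := fun β hβ => by
    have := csInf_le (coneAdmissibleExponents_bddBelow F)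
      (three_mul_mem_coneAdmissibleExponents F hβ)
    change omegaCone F ≤ 3 * β at this
    linarith
  have h3 : omegaCone F / 3 ≤ omega F := le_csInf (admissibleExponents_nonempty F) h
  linarith

/-- The kernel bracket `6 ≤ ω(W) ≤ 3ω`. [cite: ChristandlVranaZuiddam2016, §1.2] -/
theorem omegaCone_bracket : 6 ≤ omegaCone F ∧ omegaCone F ≤ 3 * omega F :=
  ⟨six_le_omegaCone F, omegaCone_le_three_mul_omega F⟩

end Exponent

/-! ## Against the summit `ω(ℂ) = 2`: necessity of both halves, sufficiency, exactness -/

/-- NEC of the «no saving» half: `ω = 2 ⟹ 3ω = 6 ≤ ω(W)` (flattening).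
[cite: ChristandlVranaZuiddam2016, §1.3] -/
theorem three_mul_omega_le_omegaCone_of_matrixMultiplication (hS : _root_.MatrixMultiplication) :
    3 * omega ℂ ≤ omegaCone ℂ := by
  have hω : omega ℂ = 2 := (_root_.MatrixMultiplication_iff).1 hS
  rw [hω]
  have := six_le_omegaCone ℂ
  linarith

/-- NEC of the «flat» half: `ω = 2 ⟹ ω(W) ≤ 3ω = 6` (triangle cover; CVZ19 §1.3: if `ω = 2` every
graph tensor sits at its flattening exponent). [cite: ChristandlVranaZuiddam2016, §1.3] -/
theorem omegaCone_le_six_of_matrixMultiplication (hS : _root_.MatrixMultiplication) :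
    omegaCone ℂ ≤ 6 := by
  have hω : omega ℂ = 2 := (_root_.MatrixMultiplication_iff).1 hS
  have hcov := omegaCone_le_three_mul_omega ℂ
  rw [hω] at hcov
  linarith

/-- SUFFICIENCY: `ω(W) ≤ 6` and `3ω ≤ ω(W)` give `ω ≤ 2`; `2 ≤ ω` is `omega_two_le`. [folklore] -/
theorem matrixMultiplication_of_cone (hA : omegaCone ℂ ≤ 6) (hB : 3 * omega ℂ ≤ omegaCone ℂ) :
    _root_.MatrixMultiplication := by
  refine (_root_.MatrixMultiplication_iff).2 (le_antisymm ?_ (omega_two_le ℂ))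
  linarith

/-- **EXACT CUT (kernel)**: `ω(ℂ) = 2 ⟺ [ω(W) ≤ 6] ∧ [3ω ≤ ω(W)]` — the squared-spoke cone sits at
its flattening exponent AND nothing is saved over three triangles. [cite: ChristandlVranaZuiddam2016, §1.3] -/
theorem matrixMultiplication_iff_cone :
    _root_.MatrixMultiplication ↔ (omegaCone ℂ ≤ 6 ∧ 3 * omega ℂ ≤ omegaCone ℂ) :=
  ⟨fun hS => ⟨omegaCone_le_six_of_matrixMultiplication hS,
      three_mul_omega_le_omegaCone_of_matrixMultiplication hS⟩,
    fun h => matrixMultiplication_of_cone h.1 h.2⟩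

/-- The «flat» half is the VALUE statement `ω(W) = 6`. [folklore] -/
theorem omegaCone_le_six_iff : omegaCone ℂ ≤ 6 ↔ omegaCone ℂ = 6 :=
  ⟨fun h => le_antisymm h (six_le_omegaCone ℂ), fun h => h.le⟩

/-- The «no saving» half is the VALUE statement `ω(W) = 3ω`. [folklore] -/
theorem three_mul_omega_le_omegaCone_iff : 3 * omega ℂ ≤ omegaCone ℂ ↔ omegaCone ℂ = 3 * omega ℂ :=
  ⟨fun h => le_antisymm (omegaCone_le_three_mul_omega ℂ) h, fun h => h.ge⟩

/-! ## What `ω(W) ≤ 6` gives on its own: `ω(4,2,2) = 6`, `ω(1,1,2) = 3`, `ω ≤ 9/4` -/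

section Grouping

variable (F : Type) [Field F]

/-- Every admissible exponent of the cone is admissible for `(4,2,2)`-rectangular matrix
multiplication (`⌈n⁴⌉ = n·n·(n·n)`, `⌈n²⌉ = n·n`, and the grouping transfer
`R(⟨n⁴,n²,n²⟩) ≤ R₄(W_n)`). [folklore] -/
theorem coneAdmissibleExponents_subset_rect :
    coneAdmissibleExponents F ⊆ rectAdmissibleExponents F 4 2 2 := by
  intro β hβ
  refine IsBigO.trans ?_ hβ
  refine IsBigO.of_bound 1 ?_
  filter_upwards [eventually_ge_atTop 1] with n hn
  rw [one_mul, Real.norm_of_nonneg (Nat.cast_nonneg _), Real.norm_of_nonneg (Nat.cast_nonneg _)]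
  haveI : NeZero n := ⟨by omega⟩
  have h4 : rectDim n 4 = n * n * (n * n) := by
    rw [show (4 : ℝ) = ((4 : ℕ) : ℝ) by norm_num, rectDim_natCast]
    ring
  have h2 : rectDim n 2 = n * n := by
    rw [show (2 : ℝ) = ((2 : ℕ) : ℝ) by norm_num, rectDim_natCast, pow_two]
  rw [tensorRank_matMulTensor_congr F h4 h2 h2]
  exact_mod_cast tensorRank_matMulTensor_le_tensorRankD_cone (F := F) n

/-- **`ω(4,2,2) ≤ ω(W)`** (grouping the rim vertices `2,3` of the cone into one party, rim edge `23`
frozen). [folklore] -/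
theorem omegaRect_four_two_two_le_omegaCone : omegaRect F 4 2 2 ≤ omegaCone F :=
  csInf_le_csInf (rectAdmissibleExponents_bddBelow F 4 2 2) (coneAdmissibleExponents_nonempty F)
    (coneAdmissibleExponents_subset_rect F)

/-- **`6 ≤ ω(4,2,2)`** (information bound). [cite: HuangPan1998, §2 eq. (2.8) (p. 262)] -/
theorem six_le_omegaRect_four_two_two : 6 ≤ omegaRect F 4 2 2 := by
  have h := add_le_omegaRect₁₂ F 4 2 2
  norm_num at h
  exact h

/-- `ω(4,2,2) = 2·ω(1,1,2)` (homogeneity and symmetry). [cite: LottiRomani1983, §1 (p. 173)] -/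
theorem omegaRect_four_two_two_eq : omegaRect F 4 2 2 = 2 * omegaRect F 1 1 2 := by
  have hs := omegaRect_smul (K := F) (t := 2) (by norm_num) (a := 2) (b := 1) (c := 1)
    (by norm_num) (by norm_num) (by norm_num)
  have h4 : ((2 : ℕ) : ℝ) * 2 = 4 := by norm_num
  have h2 : ((2 : ℕ) : ℝ) * 1 = 2 := by norm_num
  have h22 : ((2 : ℕ) : ℝ) = 2 := by norm_num
  rw [h4, h2, h22, omegaRect_rotate F 2 1 1] at hs
  exact hs

/-- **`3 ≤ ω(1,1,2)`** (information bound; record upper bound `ω(1,1,2) < 3.2504`).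
[cite: HuangPan1998, §2 eq. (2.8) (p. 262)] -/
theorem three_le_omegaRect_one_one_two : 3 ≤ omegaRect F 1 1 2 := by
  have h := add_le_omegaRect₂₃ F 1 1 2
  norm_num at h
  exact h

/-- **`ConeFlat` alone**: `ω(W) ≤ 6 → ω(4,2,2) = 6`. [folklore] -/
theorem omegaRect_four_two_two_eq_six_of_omegaCone_le_six (h : omegaCone F ≤ 6) :
    omegaRect F 4 2 2 = 6 :=
  le_antisymm ((omegaRect_four_two_two_le_omegaCone F).trans h) (six_le_omegaRect_four_two_two F)

/-- **`ConeFlat` alone gives `ω(1,1,2) = 3`**: `ω(W) ≤ 6 → ω(1,1,2) = 3`, i.e. `⟨n, n, n²⟩` in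
`n^{3+o(1)}` operations (record upper bound `3.2504`; every `CW_q`-power method bound is `≥ 3.0551`,
census Table A row `k = 2` after CLLZ arXiv:2003.03019). [folklore] -/
theorem omegaRect_one_one_two_eq_three_of_omegaCone_le_six (h : omegaCone F ≤ 6) :
    omegaRect F 1 1 2 = 3 := by
  have h6 := omegaRect_four_two_two_eq_six_of_omegaCone_le_six F h
  rw [omegaRect_four_two_two_eq F] at h6
  linarith

/-- Symmetric forms: `ω(W) ≤ 6 → ω(1,2,1) = 3 ∧ ω(2,1,1) = 3`. [folklore] -/
theorem omegaRect_perm_eq_three_of_omegaCone_le_six (h : omegaCone F ≤ 6) :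
    omegaRect F 1 2 1 = 3 ∧ omegaRect F 2 1 1 = 3 := by
  have h112 := omegaRect_one_one_two_eq_three_of_omegaCone_le_six F h
  refine ⟨?_, ?_⟩
  · rw [omegaRect_swap₂₃ F 1 2 1]
    exact h112
  · rw [omegaRect_rotate F 2 1 1]
    exact h112

/-- **`ConeFlat` alone gives `ω ≤ 9/4`**: the cyclic product `⟨n,n,n²⟩ ⊗ ⟨n,n²,n⟩ ⊗ ⟨n²,n,n⟩ =
⟨n⁴,n⁴,n⁴⟩` in exponent form (Lotti–Romani subadditivity and homogeneity): `4ω ≤ 3·ω(1,1,2) = 9`.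
[cite: LottiRomani1983, §1 (p. 173)] -/
theorem omega_le_nine_fourths_of_omegaCone_le_six (h : omegaCone F ≤ 6) : omega F ≤ 9 / 4 := by
  have h112 := omegaRect_one_one_two_eq_three_of_omegaCone_le_six F h
  obtain ⟨h121, h211⟩ := omegaRect_perm_eq_three_of_omegaCone_le_six F h
  have hsub1 := LottiRomani1983_subadditive F 1 1 2 1 2 1
  have hsub2 := LottiRomani1983_subadditive F (1 + 1) (1 + 2) (2 + 1) 2 1 1
  have hhom := LottiRomani1983_homogeneous F (ν := 4) (x := 1) (y := 1) (z := 1)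
    (by norm_num) (by norm_num) (by norm_num) (by norm_num)
  rw [omegaRect_one_one_one] at hhom
  have e4 : omegaRect F (1 + 1 + 2) (1 + 2 + 1) (2 + 1 + 1) = omegaRect F (4 * 1) (4 * 1) (4 * 1) := by
    norm_num
  linarith

/-- **`ConeFlat` alone gives `ω(2,3,3) = 6`, i.e. `ω(1,2/3,1) = 2`**: `ω(2,3,3) ≤ ω(1,1,2) + ω(1,2,1)
= 6` (Lotti–Romani subadditivity), `ω(2,3,3) = 3·ω(2/3,1,1)` (homogeneity), symmetry, and the
information bound `2 ≤ ω(1,2/3,1)`. [cite: LottiRomani1983, §1 (p. 173)] -/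
theorem omegaRect_one_twoThirds_one_eq_two_of_omegaCone_le_six (h : omegaCone F ≤ 6) :
    omegaRect F 1 (2 / 3) 1 = 2 := by
  have h112 := omegaRect_one_one_two_eq_three_of_omegaCone_le_six F h
  obtain ⟨h121, -⟩ := omegaRect_perm_eq_three_of_omegaCone_le_six F h
  have h233 : omegaRect F 2 3 3 ≤ 6 := by
    have hsub := LottiRomani1983_subadditive F 1 1 2 1 2 1
    norm_num at hsub
    linarith
  have hhom : omegaRect F 2 3 3 = 3 * omegaRect F (2 / 3) 1 1 := by
    have hh := LottiRomani1983_homogeneous F (ν := 3) (x := 2 / 3) (y := 1) (z := 1)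
      (by norm_num) (by norm_num) (by norm_num) (by norm_num)
    norm_num at hh
    exact hh
  have hsw : omegaRect F (2 / 3) 1 1 = omegaRect F 1 (2 / 3) 1 := omegaRect_swap₁₂ F (2 / 3) 1 1
  have hlow := add_le_omegaRect₁₃ F 1 (2 / 3) 1
  norm_num at hlow
  linarith

/-- **`ConeFlat` alone gives `α ≥ 2/3`** (record `α > 0.321334`; every `CW_q`-power method is capped
at `α ≤ 0.6407 < 2/3`, census Table B row `r = 1` after CLLZ arXiv:2003.03019 — so this consequence,
hence `ConeFlat`, lies OUTSIDE the Coppersmith–Winograd method class). [folklore] -/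
theorem twoThirds_le_dualExponentAlpha_of_omegaCone_le_six (h : omegaCone F ≤ 6) :
    2 / 3 ≤ dualExponentAlpha F :=
  le_dualExponentAlpha (K := F) ⟨by norm_num, by norm_num⟩
    (omegaRect_one_twoThirds_one_eq_two_of_omegaCone_le_six F h)

/-- The bracket of consequences of `ConeFlat` alone, in kernel: `ω(1,1,2) = 3`, `α ≥ 2/3` and
`ω ≤ 9/4` (and, via the four apex-permuted cones `⊠_v W^{(v)}_n ≅ T(K₄)_{n⁶}`, also `ω(K₄) ≤ 4` —
see `ConeTensorApex`). [folklore] -/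
theorem coneFlat_consequences (h : omegaCone F ≤ 6) :
    omegaRect F 1 1 2 = 3 ∧ 2 / 3 ≤ dualExponentAlpha F ∧ omega F ≤ 9 / 4 :=
  ⟨omegaRect_one_one_two_eq_three_of_omegaCone_le_six F h,
    twoThirds_le_dualExponentAlpha_of_omegaCone_le_six F h,
    omega_le_nine_fourths_of_omegaCone_le_six F h⟩

end Grouping

end Summit.MatrixMultiplication.MatrixMultiplication.Theorems.ConeTensor

end
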